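import Summits.PneNP.PneNP.Theses.Circuit
import Literature.Computability.Complexity.SymPlus
import Literature.Computability.Complexity.NondeterministicProofs
import Literature.Computability.Complexity.CircuitClassesProofs

/-!
# Skeleton — crux stmt-PneNP-0037 `CircuitNpAcc0` (¬ (NP ⊆ ACC⁰)), line `Sketch`, Jacobi level-set road

Lead prover's registered skeleton (prover-line-stmt-PneNP-0037-0). Sorries ONLY in `stub_*`; the
composition `CircuitNpAcc0_of` is sorry-free and concludes the crux BY NAME from the four stub
statements.

Road (crux card `Cruxes/CircuitNpAcc0/Ideas/jacobi-levelset-discrepancy.md`): take the explicit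
`P`-language `JACOBI₂ = {w = (u, v) : (N(u) | 2 N(v) + 1) = +1}` (Jacobi symbol of the two halves of the
input read as little-endian binary numbers). If `NP ⊆ ACC⁰` then `JACOBI₂ ∈ P ⊆ NP ⊆ ACC⁰`
(`stub_jacobi2_mem_P`, `P_subset_NP_holds`), so by the Yao–Beigel–Tarui representation theorem — PROVED in
the tree (`Williams2014_symPlus_of_acc_holds`, `Circuit.exists_normFanIn`), packaged at the language level
as `stub_symPlus_of_mem_ACC0` — every large slice of `JACOBI₂` is `x ↦ sym (count_S x)` for a `SYM⁺` term
system `S` of quasi-polynomial size and polylogarithmic fan-in. The slice indicator `[χ₂ = 1]` is then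
constant on every level set `{count_S = v}`, and pigeonhole over the `size + 1` level sets
(`stub_levelset_bias_of_symPlus`) yields a level set carrying character bias
`|Σ_{count = v} χ₂| · (size + 1) ≥ #{χ₂ ≠ 0}`, contradicting the transferred crux
`C⁺ = LevelSetDiscrepancy₂` (`stub_levelSetDiscrepancy2`, OPEN — the line's one non-bookkeeping stub:
real-character cancellation over level sets of admissible digit polynomials).

§1 = the line's vocabulary (to be landed verbatim as `Theorems/CircuitCircuitNpAcc0Defs.lean`); the three
provable stubs S1–S3 are stated WITHOUT the new vocabulary so that they land independently of the Defs
review (`stub_jacobi2_mem_P` is `JACOBI₂ ∈ P` with `JACOBI₂` unfolded; definitional equality is used in the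
composition).
-/

set_option linter.dupNamespace false -- `Summit.PneNP.PneNP.…`: summit = sub-problem (D-0017)

namespace Summit.PneNP.PneNP.Theorems.CircuitNpAcc0

open Finset Literature.Computability.Complexity

noncomputable section

/-! ## §1 Vocabulary -/

/-- `χ₂(w) = (N(u) | 2·N(v) + 1)`: the Jacobi symbol of the two halves of the word `w` — `u` = the first
`⌊|w|/2⌋` bits, `v` = the remaining bits, both read as little-endian binary numerals (`bitsToNat`); the
bottom argument `2·N(v) + 1` is odd and positive, so Mathlib's `jacobiSym` is the genuine Jacobi symbol.
(line vocabulary) -/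
def jacobiPairSym (w : List Bool) : ℤ :=
  jacobiSym (bitsToNat (w.take (w.length / 2)) : ℤ) (2 * bitsToNat (w.drop (w.length / 2)) + 1)

/-- The language `JACOBI₂ = {w | χ₂(w) = +1}` (in `P` by the binary Jacobi algorithm / reciprocity).
(line vocabulary) -/
def JACOBI₂ : Language Bool :=
  {w | jacobiPairSym w = 1}

/-- The slice character `chi₂ n : (Fin n → Bool) → ℤ`, `x ↦ χ₂(List.ofFn x)` (values in `{0, 1, -1}`).
(line vocabulary) -/
def chi₂ (n : ℕ) (x : Fin n → Bool) : ℤ :=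
  jacobiPairSym (List.ofFn x)

/-- **C⁺ = `LevelSetDiscrepancy₂`** (the transferred crux of the line): for every exponent `e`, for all
large `n`, every `SYM⁺` term system `S` on `n` variables with at most `2 ^ (log₂ n + 2) ^ e` terms, each
of fan-in at most `(log₂ n + 2) ^ e`, and every level `v`, the character sum of `χ₂` over the level set
`{x | count_S x = v}` times the number of levels `size + 1` is below `#{x | χ₂ x ≠ 0}` — no level set of an
admissible digit polynomial carries a `1/(size+1)` fraction of full character bias. OPEN (the line's
crux-sized stub). (line vocabulary) -/
def LevelSetDiscrepancy₂ : Prop :=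
  ∀ e : ℕ, ∃ n₀ : ℕ, ∀ n ≥ n₀, ∀ S : SymPlus n,
    S.size ≤ 2 ^ (Nat.log 2 n + 2) ^ e → S.maxFanIn ≤ (Nat.log 2 n + 2) ^ e →
    ∀ v : ℕ, |∑ x ∈ univ.filter (fun x => S.count x = v), chi₂ n x| * ((S.size : ℤ) + 1) <
      ((univ.filter fun x => chi₂ n x ≠ 0).card : ℤ)

/-! ## §2 Readback -/

/-- Readback: the crux is LITERALLY `¬ (NP ⊆ ACC0)`. (line vocabulary) -/
theorem crux_iff : Summit.PneNP.PneNP.Theses.Circuit.CircuitNpAcc0 ↔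
    ¬ (Nondeterministic.NP ⊆ ACC0) :=
  Iff.rfl

/-! ## §3 The stubs -/

/-- STUB S1 (`stub_symPlus_of_mem_ACC0`): **`ACC⁰ ⊆ SYM⁺` at the language level** — every `ACC⁰`
language has, at all large lengths `n`, a `SYM⁺` term system with at most `2 ^ (log₂ n + 2) ^ e` terms of
fan-in at most `(log₂ n + 2) ^ e` computing its slice. Bookkeeping over the tree's PROVED theorems
`Williams2014_symPlus_of_acc_holds` (Yao–Beigel–Tarui, per circuit, bounds in `s`) and
`Circuit.exists_normFanIn` (fan-in `≤ m (n + size)`), with `s = poly(n)` absorbed into one exponent. -/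
theorem stub_symPlus_of_mem_ACC0 : ∀ L ∈ ACC0, ∃ e n₀ : ℕ, ∀ n ≥ n₀, ∃ S : SymPlus n,
    S.size ≤ 2 ^ (Nat.log 2 n + 2) ^ e ∧ S.maxFanIn ≤ (Nat.log 2 n + 2) ^ e ∧
      ∀ x, S.eval x = L.sliceFn n x := by
  sorry

/-- STUB S2 (`stub_levelset_bias_of_symPlus`): **pigeonhole over level sets** — if a `{0, ±1}`-valued
`χ` has `[χ = 1]` constant on every level set of `count_S`, then some level set has
`#{χ ≠ 0} ≤ |Σ_{count = v} χ| · (size + 1)` (on a level set either `χ ≡ 1` or `χ ∈ {0, -1}`, so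
`|Σ_{L_v} χ| = #{x ∈ L_v | χ x ≠ 0}`, and the `size + 1` levels `v ≤ size` exhaust the cube). -/
theorem stub_levelset_bias_of_symPlus {n : ℕ} (S : SymPlus n) (χ : (Fin n → Bool) → ℤ)
    (hχ : ∀ x, χ x = 0 ∨ χ x = 1 ∨ χ x = -1)
    (hrep : ∀ x y, S.count x = S.count y → (χ x = 1 ↔ χ y = 1)) :
    ∃ v : ℕ, ((univ.filter fun x => χ x ≠ 0).card : ℤ) ≤
      |∑ x ∈ univ.filter (fun x => S.count x = v), χ x| * ((S.size : ℤ) + 1) := by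
  sorry

/-- STUB S3 (`stub_jacobi2_mem_P`): **`JACOBI₂ ∈ P`** (stated with `JACOBI₂` unfolded): split the word
in halves, canonicalise the two numerals, form `2 N(v) + 1`, run the tree's polynomial-time Jacobi
algorithm `stub_jacobiSymCodeFP` (QuantumAdvantage Theorems), compare with `+1`. -/
theorem stub_jacobi2_mem_P :
    {w : List Bool | jacobiSym (bitsToNat (w.take (w.length / 2)) : ℤ)
      (2 * bitsToNat (w.drop (w.length / 2)) + 1) = 1} ∈ Classes.P := by
  sorry

/-- STUB S4 (`stub_levelSetDiscrepancy2`, lead): **C⁺** — the level-set discrepancy conjecture for the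
Jacobi symbol of the two input halves. OPEN. -/
theorem stub_levelSetDiscrepancy2 : LevelSetDiscrepancy₂ := by
  sorry

/-! ## §4 Registered aliases and the composition -/

namespace __Registered

/-- Alias keyed by the registered stub name `stub_symPlus_of_mem_ACC0`. -/
abbrev stub_symPlus_of_mem_ACC0 : Prop :=
  ∀ L ∈ ACC0, ∃ e n₀ : ℕ, ∀ n ≥ n₀, ∃ S : SymPlus n,
    S.size ≤ 2 ^ (Nat.log 2 n + 2) ^ e ∧ S.maxFanIn ≤ (Nat.log 2 n + 2) ^ e ∧
      ∀ x, S.eval x = L.sliceFn n x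

/-- Alias keyed by the registered stub name `stub_levelset_bias_of_symPlus`. -/
abbrev stub_levelset_bias_of_symPlus : Prop :=
  ∀ {n : ℕ} (S : SymPlus n) (χ : (Fin n → Bool) → ℤ), (∀ x, χ x = 0 ∨ χ x = 1 ∨ χ x = -1) →
    (∀ x y, S.count x = S.count y → (χ x = 1 ↔ χ y = 1)) →
    ∃ v : ℕ, ((univ.filter fun x => χ x ≠ 0).card : ℤ) ≤
      |∑ x ∈ univ.filter (fun x => S.count x = v), χ x| * ((S.size : ℤ) + 1)

/-- Alias keyed by the registered stub name `stub_jacobi2_mem_P`. -/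
abbrev stub_jacobi2_mem_P : Prop :=
  {w : List Bool | jacobiSym (bitsToNat (w.take (w.length / 2)) : ℤ)
      (2 * bitsToNat (w.drop (w.length / 2)) + 1) = 1} ∈ Classes.P

/-- Alias keyed by the registered stub name `stub_levelSetDiscrepancy2`. -/
abbrev stub_levelSetDiscrepancy2 : Prop :=
  LevelSetDiscrepancy₂

end __Registered

/-- **COMPOSITION — the line concludes the crux** (sorry-free): hypotheses = the four registered stubs,
by name; conclusion = the crux BY NAME. If `NP ⊆ ACC⁰` then `JACOBI₂ ∈ ACC⁰`; at a length `n` beyond both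
thresholds take the `SYM⁺` system of S1, feed the pigeonhole S2 with `χ = chi₂ n` (trichotomy of the
Jacobi symbol; `[chi₂ = 1]` is the slice of `JACOBI₂`, constant on level sets), and contradict C⁺. -/
theorem CircuitNpAcc0_of :
    __Registered.stub_symPlus_of_mem_ACC0 → __Registered.stub_levelset_bias_of_symPlus →
    __Registered.stub_jacobi2_mem_P → __Registered.stub_levelSetDiscrepancy2 →
    Summit.PneNP.PneNP.Theses.Circuit.CircuitNpAcc0 := by
  intro hBT hPH hP hC
  rw [crux_iff]
  intro hsub
  have hJP : JACOBI₂ ∈ Classes.P := hP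
  have hJACC : JACOBI₂ ∈ ACC0 := hsub (P_subset_NP_holds hJP)
  obtain ⟨e, n₁, hS⟩ := hBT JACOBI₂ hJACC
  obtain ⟨n₀, hn₀⟩ := hC e
  obtain ⟨S, hsize, hfan, heval⟩ := hS (max n₀ n₁) (le_max_right _ _)
  have hχ : ∀ x, chi₂ (max n₀ n₁) x = 0 ∨ chi₂ (max n₀ n₁) x = 1 ∨ chi₂ (max n₀ n₁) x = -1 :=
    fun x => jacobiSym.trichotomy _ _
  have hrep : ∀ x y, S.count x = S.count y →
      (chi₂ (max n₀ n₁) x = 1 ↔ chi₂ (max n₀ n₁) y = 1) := by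
    intro x y hxy
    have hev : S.eval x = S.eval y := by simp only [SymPlus.eval, hxy]
    rw [heval x, heval y] at hev
    have key : ∀ z : Fin (max n₀ n₁) → Bool,
        JACOBI₂.sliceFn (max n₀ n₁) z = true ↔ chi₂ (max n₀ n₁) z = 1 := fun z =>
      (Set.mem_iff_boolIndicator (s := (JACOBI₂ : Set (List Bool))) (List.ofFn z)).symm
    rw [← key, ← key, hev]
  obtain ⟨v, hv⟩ := hPH S (chi₂ (max n₀ n₁)) hχ hrep
  exact absurd (hn₀ (max n₀ n₁) (le_max_left _ _) S hsize hfan v) (not_lt.2 hv)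

/-- The composition fed with the stubs themselves (the closing Theorems file states this as the theorem
`circuitNpAcc0_proof` once the four stubs are landed sorry-free). -/
example : Summit.PneNP.PneNP.Theses.Circuit.CircuitNpAcc0 :=
  CircuitNpAcc0_of stub_symPlus_of_mem_ACC0 stub_levelset_bias_of_symPlus stub_jacobi2_mem_P
    stub_levelSetDiscrepancy2

end

end Summit.PneNP.PneNP.Theorems.CircuitNpAcc0
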